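import Mathlib.NumberTheory.Harmonic.Bounds
import Literature.MathematicalPhysics.QuantumLattice.HubbardHubbardModel
import Literature.MathematicalPhysics.QuantumLattice.HubbardGaugeBound
import Literature.MathematicalPhysics.QuantumLattice.TraceInequalitiesProofs
import Literature.MathematicalPhysics.QuantumLattice.TorusTestPotential
import HarnessLib

/-!
# Discharge of `Literature.MathematicalPhysics.QuantumLattice.koma_tasaki_2d` (Koma–Tasaki: power-law decay of pair correlations)

Family `hubbard` (trunk T-QLATTICE), statement hubbard.S11. Sibling proof file of
`Literature/MathematicalPhysics/QuantumLattice/HubbardHubbardModel.lean`: it proves the named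
fact `koma_tasaki_2d` (`def … : Prop`, D-0014) of that file from Mathlib and the accepted
prelude. No statement is introduced or changed here.

Proved here:

* `Literature.MathematicalPhysics.QuantumLattice.norm_gibbsState_le_of_gauge` — the Gibbs-state form of the model-independent
  trace bound `Literature.MathematicalPhysics.QuantumLattice.koma_tasaki_trace_bound` of `TraceInequalitiesProofs` (eqs. (6),
  (10), (11) of the source: trace Cauchy–Schwarz, Bernstein, Golden–Thompson): if `D A D⁻¹ = κ A`
  and the Hermitian part of `D H D⁻¹` is `H + V` with `‖V‖ ≤ c`, then `|⟨A⟩_β| ≤ |κ| ‖A‖ e^{βc}`;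
* `Literature.MathematicalPhysics.QuantumLattice.norm_thermalCorr_pair_le_exp` — **Koma–Tasaki's a priori bound** for the
  Hubbard model `H(t, U) - μ N` on an arbitrary finite graph: for every real site function `φ`
  and `β ≥ 0`,
  `|⟨c†_{x↑} c†_{x↓} c_{y↓} c_{y↑}⟩_β|`
  `  ≤ exp[-2(φ_x - φ_y)] · exp[β |t| Σ_u Σ_v [u ∼ v] 2 (cosh(φ_u - φ_v) - 1)]`
  (eqs. (6)–(10) and the first bound of (11) of the source, with the gauge transformation,
  the pair eigenvalue (8) and the perturbation bound of `HubbardGaugeBound`);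
* `Literature.Hubbard.koma_tasaki_2d_holds : koma_tasaki_2d` — on the tori `(ℤ/Lℤ)²`, for all
  `t, U, μ` and `β > 0`: `|⟨c†_{x↑} c†_{x↓} c_{y↓} c_{y↑}⟩_{β,L}| ≤ (dist(x, y) + 1)^{-f}` with
  `f = 2q - B q² > 0`, `q = 1/(1 + B)`, `B = 128 β |t|` (so `C = 1`; `f = (2 + B)/(1 + B)²`
  depends on `β |t|` only and `f ~ 1/(128 β |t|)` as `β → ∞`, the `β⁻¹` behaviour of the power
  stated in the Theorem of the source, with a worse constant),
  from the a priori bound with the test potential of `TorusTestPotential`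
  (`φ_x - φ_y = q H(D) ≥ q log(1 + D)`, energy `≤ 128 q² H(D)`, `D = dist(x, y)`,
  `H` = harmonic numbers).

## Source and proof architecture

T. Koma, H. Tasaki, *Decay of superconducting and magnetic correlations in one- and
two-dimensional Hubbard models*, Phys. Rev. Lett. **68** (1992) 3248–3251
= arXiv:cond-mat/9709068, Theorem (eq. (2)) and its proof, eqs. (5)–(12): with the non-unitary
gauge transformation `G = exp[-Σ_u φ_u n_u]` one has `G A G⁻¹ = e^{-2(φ_x - φ_y)} A` (8) and
`G H G⁻¹ = H + U + iP` (9); the trace inequalities i)–iv) give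
`|Tr[A e^{-βH}]| ≤ e^{-2(φ_x-φ_y)} ‖e^{-βU}‖ Tr[e^{-βH}]` (10), and
`‖e^{-βU}‖ ≤ exp[β Σ_{u,v} |t_{uv} (cosh(φ_u - φ_v) - 1)|]` (first bound of (11)), whence the
finite-volume bound (12) on `|⟨A⟩_L|` for every real `φ`. The source then inserts the lattice
Green's function (the Poisson equation before (11), properties P1), P2)) and optimises the charge
`q` (13)–(14); the vendored statement `koma_tasaki_2d` asks only for *some* `f(β) > 0` uniformly
in `L`, for which the explicit logarithmic test potential suffices (the exponent obtained here is
not the optimal `α f(β)` of the Theorem).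
-/

noncomputable section

open Matrix Finset NormedSpace Literature.MathematicalPhysics.QuantumLattice Literature.Probability.LatticeModels
open scoped Matrix.Norms.L2Operator ComplexOrder

namespace Literature.MathematicalPhysics.QuantumLattice

section GibbsState

variable {n : Type*} [Fintype n] [DecidableEq n] [Nonempty n]

/-- **Koma–Tasaki's a priori bound for the Gibbs state** `⟨A⟩_β = tr (e^{-βH} A) / tr e^{-βH}`
(`Matrix.gibbsState`), in the form consumed below: `H` Hermitian, `D` invertible with
`D A D⁻¹ = κ A`, `D H D⁻¹ + (D H D⁻¹)ᴴ = 2 (H + V)` (i.e. `V` is the Hermitian part of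
`D H D⁻¹ - H`) and `‖V‖ ≤ c` (operator norm); then for every `β ≥ 0`,
`|⟨A⟩_β| ≤ |κ| ‖A‖ e^{βc}`. This is `koma_tasaki_trace_bound` (`TraceInequalitiesProofs`, the
matrix form of eqs. (6), (10), (11) of the source) applied to `βH`, whose perturbation is
`U = βV`, together with `‖e^{-βV}‖ ≤ e^{β‖V‖}` and `tr e^{-βH} = Z > 0`.
Koma–Tasaki, PRL 68 (1992) 3248, eqs. (6), (10)–(12). [cite: KomaTasakiPRL1992, eqs. (6), (10)–(12)] -/
theorem norm_gibbsState_le_of_gauge {H A D V : Matrix n n ℂ} (hH : H.IsHermitian)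
    (hD : IsUnit D) {κ : ℂ} (hA : D * A * D⁻¹ = κ • A)
    (hV : D * H * D⁻¹ + (D * H * D⁻¹)ᴴ = (2 : ℂ) • (H + V)) {c : ℝ} (hc : ‖V‖ ≤ c)
    {β : ℝ} (hβ : 0 ≤ β) :
    ‖gibbsState β H A‖ ≤ ‖κ‖ * ‖A‖ * Real.exp (β * c) := by
  -- the gauge transformation as a unit
  set G : (Matrix n n ℂ)ˣ := hD.unit with hG_def
  have hG : (G : Matrix n n ℂ) = D := hD.unit_spec
  have hGinv : ((G⁻¹ : (Matrix n n ℂ)ˣ) : Matrix n n ℂ) = D⁻¹ := by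
    rw [Matrix.coe_units_inv, hG]
  have hA' : (G : Matrix n n ℂ) * A * ((G⁻¹ : (Matrix n n ℂ)ˣ) : Matrix n n ℂ) = κ • A := by
    rw [hG, hGinv]; exact hA
  have hβH : ((β : ℂ) • H).IsHermitian := isHermitian_real_smul hH β
  -- the Hermitian part of the conjugated `βH` minus `βH` is `βV`
  have hU : (2 : ℂ)⁻¹ • ((G : Matrix n n ℂ) * ((β : ℂ) • H) * ((G⁻¹ : (Matrix n n ℂ)ˣ) : Matrix n n ℂ) +
      ((G : Matrix n n ℂ) * ((β : ℂ) • H) * ((G⁻¹ : (Matrix n n ℂ)ˣ) : Matrix n n ℂ))ᴴ) -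
        (β : ℂ) • H = (β : ℂ) • V := by
    rw [hG, hGinv, Matrix.mul_smul, Matrix.smul_mul, conjTranspose_smul]
    have hs : star (β : ℂ) = β := Complex.conj_ofReal β
    rw [hs, ← smul_add, hV]
    module
  have key := koma_tasaki_trace_bound hβH G A κ hA'
  rw [hU] at key
  -- `‖βV‖ ≤ βc`
  have hnU : ‖(β : ℂ) • V‖ ≤ β * c := by
    rw [norm_smul, Complex.norm_real, Real.norm_of_nonneg hβ]
    exact mul_le_mul_of_nonneg_left hc hβ
  -- the partition function is a positive real
  have hZ : 0 < partitionFn β H := partitionFn_pos β hH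
  have hZre : 0 < (partitionFn β H).re := (Complex.pos_iff.mp hZ).1
  have hZeq : partitionFn β H = ((partitionFn β H).re : ℂ) := by
    apply Complex.ext <;> simp [← (Complex.pos_iff.mp hZ).2]
  have hnormZ : ‖partitionFn β H‖ = (partitionFn β H).re := by
    rw [hZeq, Complex.norm_real, Real.norm_of_nonneg hZre.le, Complex.ofReal_re]
  have hw : gibbsWeight β H = exp (-((β : ℂ) • H)) := by rw [gibbsWeight, neg_smul]
  have hZw : (exp (-((β : ℂ) • H))).trace.re = (partitionFn β H).re := by
    rw [partitionFn, hw]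
  have htr : (gibbsWeight β H * A).trace = (A * exp (-((β : ℂ) • H))).trace := by
    rw [hw, trace_mul_comm]
  rw [gibbsState_apply, norm_mul, norm_inv, hnormZ, inv_mul_le_iff₀ hZre, htr]
  calc ‖(A * exp (-((β : ℂ) • H))).trace‖
      ≤ ‖κ‖ * ‖A‖ * Real.exp ‖(β : ℂ) • V‖ * (exp (-((β : ℂ) • H))).trace.re := key
    _ ≤ ‖κ‖ * ‖A‖ * Real.exp (β * c) * (exp (-((β : ℂ) • H))).trace.re := by
        rw [hZw]
        gcongr
    _ = (partitionFn β H).re * (‖κ‖ * ‖A‖ * Real.exp (β * c)) := by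
        rw [hZw]; ring

end GibbsState

variable {Λ : Type*} [LinearOrder Λ] [Fintype Λ] (G : SimpleGraph Λ) [DecidableRel G.Adj]

/-- **Koma–Tasaki's a priori bound** (eqs. (6)–(10), (12) before the choice of `φ`): for the
grand-canonical Hubbard model on a finite graph, every real site function `φ` and `β ≥ 0`,
`|⟨c†_{x↑} c†_{x↓} c_{y↓} c_{y↑}⟩_β|`
`  ≤ e^{-2(φ_x - φ_y)} exp[β |t| Σ_u Σ_v [u ∼ v] 2(cosh(φ_u - φ_v) - 1)]`.
Koma–Tasaki, PRL 68 (1992) 3248, eqs. (6)–(12). [cite: KomaTasakiPRL1992, eqs. (6)–(12)] -/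
theorem norm_thermalCorr_pair_le_exp (t U μ : ℝ) {β : ℝ} (hβ : 0 ≤ β) (φ : Λ → ℝ) (x y : Λ) :
    ‖(hamiltonianWith G t U μ).thermalCorr β (creation (orb x 0) * creation (orb x 1))
        (annihilation (orb y 1) * annihilation (orb y 0))‖ ≤
      Real.exp (-2 * (φ x - φ y)) *
        Real.exp (β * (|t| * ∑ u : Λ, ∑ v : Λ,
          if G.Adj u v then 2 * (Real.cosh (φ u - φ v) - 1) else 0)) := by
  set H : Matrix (Finset (Orb Λ)) (Finset (Orb Λ)) ℂ := hamiltonianWith G t U μ with hH_def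
  set A : Matrix (Finset (Orb Λ)) (Finset (Orb Λ)) ℂ :=
    creation (orb x 0) * creation (orb x 1) * (annihilation (orb y 1) * annihilation (orb y 0))
    with hA_def
  set V : Matrix (Finset (Orb Λ)) (Finset (Orb Λ)) ℂ :=
    -(t : ℂ) • hoppingForm G (fun u v => Real.cosh (φ u - φ v) - 1) with hV_def
  set c : ℝ := |t| * ∑ u : Λ, ∑ v : Λ,
    if G.Adj u v then 2 * (Real.cosh (φ u - φ v) - 1) else 0 with hc_def
  have hH : H.IsHermitian := isHermitian_hamiltonianWith G t U μ
  have hD : IsUnit (siteGauge φ) := isUnit_siteGauge φ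
  have hA : siteGauge φ * A * (siteGauge φ)⁻¹ =
      ((Real.exp (-2 * (φ x - φ y)) : ℝ) : ℂ) • A := by
    rw [siteGauge_inv]
    exact siteGauge_mul_pair_mul φ x y
  have hV : siteGauge φ * H * (siteGauge φ)⁻¹ + (siteGauge φ * H * (siteGauge φ)⁻¹)ᴴ =
      (2 : ℂ) • (H + V) := by
    rw [siteGauge_inv]
    exact siteGauge_conj_hamiltonianWith_add_conjTranspose G φ t U μ
  have hc : ‖V‖ ≤ c := norm_hoppingPerturbation_le G φ t
  have h := norm_gibbsState_le_of_gauge hH hD hA hV hc hβ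
  have hκ : ‖((Real.exp (-2 * (φ x - φ y)) : ℝ) : ℂ)‖ = Real.exp (-2 * (φ x - φ y)) := by
    rw [Complex.norm_real, Real.norm_of_nonneg (Real.exp_pos _).le]
  have hthermal : H.thermalCorr β (creation (orb x 0) * creation (orb x 1))
      (annihilation (orb y 1) * annihilation (orb y 0)) = gibbsState β H A := rfl
  rw [hthermal]
  calc ‖gibbsState β H A‖
      ≤ ‖((Real.exp (-2 * (φ x - φ y)) : ℝ) : ℂ)‖ * ‖A‖ * Real.exp (β * c) := h
    _ ≤ ‖((Real.exp (-2 * (φ x - φ y)) : ℝ) : ℂ)‖ * 1 * Real.exp (β * c) := by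
        gcongr
        exact norm_pair_le_one x y
    _ = Real.exp (-2 * (φ x - φ y)) * Real.exp (β * c) := by rw [hκ, mul_one]

end Literature.MathematicalPhysics.QuantumLattice

namespace Literature.MathematicalPhysics.QuantumLattice


/-- **hubbard.S11, discharged** (Koma–Tasaki, `d = 2`, superconducting correlations): for the
Hubbard model on the tori `(ℤ/Lℤ)²`, all `t, U, μ` and `β > 0`, uniformly in `L`,
`|⟨c†_{x↑} c†_{x↓} c_{y↓} c_{y↑}⟩_{β, L}| ≤ (dist(x, y) + 1)^{-f}` with
`f = 2q - Bq² > 0`, `q = 1/(1 + B)`, `B = 128 β|t|`. Proof: the a priori bound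
`norm_thermalCorr_pair_le_exp` on the fermionic torus with the test potential of
`exists_torusTestPotential` pulled back along `FermionTorus.toTorusSite`, and
`H(D) ≥ log(1 + D)`. Koma–Tasaki, PRL 68 (1992) 3248, Theorem (eq. (2), `d = 2`), proof
eqs. (5)–(12). [cite: KomaTasakiPRL1992, Theorem eq. (2) (d = 2); proof eqs. (5)–(12)] -/
theorem koma_tasaki_2d_holds : koma_tasaki_2d := by
  intro t U μ β hβ
  -- constants
  set B : ℝ := 128 * (β * |t|) with hB
  have hB0 : 0 ≤ B := by positivity
  set q : ℝ := 1 / (1 + B) with hq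
  have hq0 : 0 < q := by positivity
  have hq1 : q ≤ 1 := by
    rw [hq, div_le_one (by positivity)]
    linarith
  have hBq : B * q ≤ 1 := by
    rw [hq, mul_one_div, div_le_one (by positivity)]
    linarith
  set f : ℝ := 2 * q - B * q ^ 2 with hf
  have hf0 : 0 < f := by
    have h1 : B * q ^ 2 ≤ q := by nlinarith
    rw [hf]
    linarith
  refine ⟨f, hf0, 1, ?_⟩
  intro L _ x y
  -- the test potential on `(ℤ/Lℤ)²`, pulled back to the fermionic torus
  obtain ⟨ψ, hψy, hψx, hE⟩ := exists_torusTestPotential L x y hq0.le hq1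
  have key := norm_thermalCorr_pair_le_exp (fermionTorusGraph 2 L) t U μ hβ.le
    (fun u => ψ (FermionTorus.toTorusSite u)) (FermionTorus.ofTorusSite x)
    (FermionTorus.ofTorusSite y)
  have hsumeq : (∑ u : FermionTorus 2 L, ∑ v : FermionTorus 2 L,
      if (fermionTorusGraph 2 L).Adj u v then
        2 * (Real.cosh (ψ (FermionTorus.toTorusSite u) - ψ (FermionTorus.toTorusSite v)) - 1)
      else 0) =
      ∑ a : TorusSite 2 L, ∑ b : TorusSite 2 L,
        if (torusGraph 2 L).Adj a b then 2 * (Real.cosh (ψ a - ψ b) - 1) else 0 := by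
    refine Fintype.sum_equiv FermionTorus.equivTorusSite _ _ fun u => ?_
    refine Fintype.sum_equiv FermionTorus.equivTorusSite _ _ fun v => ?_
    simp [FermionTorus.equivTorusSite]
  simp only [FermionTorus.toTorusSite_ofTorusSite, hψy, hψx, sub_zero] at key
  rw [hsumeq] at key
  have hrw : (hubbardTorusWith 2 L t U μ).thermalCorr β (onSitePair x)ᴴ (onSitePair y) =
      (hamiltonianWith (fermionTorusGraph 2 L) t U μ).thermalCorr β
        (creation (orb (FermionTorus.ofTorusSite x) 0) *
          creation (orb (FermionTorus.ofTorusSite x) 1))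
        (annihilation (orb (FermionTorus.ofTorusSite y) 1) *
          annihilation (orb (FermionTorus.ofTorusSite y) 0)) := by
    rw [onSitePair_conjTranspose]
    rfl
  rw [hrw]
  -- `key` carries the instance arguments of the generic graph statement; bridge them by congruence
  refine Eq.trans_le ?_ (key.trans ?_)
  · congr!
  -- arithmetic: `exp(-2qH_D) exp(β|t|E) ≤ exp(-f H_D) ≤ (D+1)^{-f}`
  set D : ℕ := torusDist x y with hD
  have hHD : Real.log ((D : ℝ) + 1) ≤ (harmonic D : ℝ) := by
    have := log_add_one_le_harmonic D
    push_cast at this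
    exact this
  have hHD0 : 0 ≤ (harmonic D : ℝ) := (Real.log_nonneg (by
    have : (0 : ℝ) ≤ D := Nat.cast_nonneg D
    linarith)).trans hHD
  have hβt : 0 ≤ β * |t| := by positivity
  have hE' : β * (|t| * ∑ a : TorusSite 2 L, ∑ b : TorusSite 2 L,
      (if (torusGraph 2 L).Adj a b then 2 * (Real.cosh (ψ a - ψ b) - 1) else 0)) ≤
      B * q ^ 2 * (harmonic D : ℝ) := by
    calc β * (|t| * ∑ a : TorusSite 2 L, ∑ b : TorusSite 2 L,
          (if (torusGraph 2 L).Adj a b then 2 * (Real.cosh (ψ a - ψ b) - 1) else 0))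
        = (β * |t|) * ∑ a : TorusSite 2 L, ∑ b : TorusSite 2 L,
          (if (torusGraph 2 L).Adj a b then 2 * (Real.cosh (ψ a - ψ b) - 1) else 0) := by
          ring
      _ ≤ (β * |t|) * (128 * q ^ 2 * (harmonic D : ℝ)) := mul_le_mul_of_nonneg_left hE hβt
      _ = B * q ^ 2 * (harmonic D : ℝ) := by rw [hB]; ring
  have hDpos : (0 : ℝ) < (D : ℝ) + 1 := by positivity
  calc Real.exp (-2 * (q * (harmonic D : ℝ))) *
        Real.exp (β * (|t| * ∑ a : TorusSite 2 L, ∑ b : TorusSite 2 L,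
          (if (torusGraph 2 L).Adj a b then 2 * (Real.cosh (ψ a - ψ b) - 1) else 0)))
      ≤ Real.exp (-2 * (q * (harmonic D : ℝ))) * Real.exp (B * q ^ 2 * (harmonic D : ℝ)) := by
        gcongr
    _ = Real.exp (-(f * (harmonic D : ℝ))) := by
        rw [← Real.exp_add, hf]
        congr 1
        ring
    _ ≤ Real.exp (-(f * Real.log ((D : ℝ) + 1))) := by
        gcongr
    _ = 1 * (((torusDist x y : ℕ) : ℝ) + 1) ^ (-f) := by
        rw [one_mul, ← hD, Real.rpow_def_of_pos hDpos]
        congr 1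
        ring

end Literature.MathematicalPhysics.QuantumLattice
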